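import Summits.ResolutionOfSingularities.ResolutionOfSingularities.Theorems.WeightedInvariantTiePresentationTransfer
import Summits.ResolutionOfSingularities.ResolutionOfSingularities.Theorems.WeightedInvariantContactCylinderGlobalMoveDictionary
import HarnessLib

/-!
# Finiteness of the tie points, in-chart step (Wtie): EVERY TIE POINT OF THE CURVE IS CAUGHT BY THE GLOBAL NO-DROP LOCUS —
# door `HypersurfaceCentreConstruction` (stmt-ResolutionOfSingularities-19897), route `WeightedInvariant`, P3 rung `KeyRungGrLE 3 p`,
# clause (c8)≤3,p for the letter `τ`

[OURS · L1 W4.3 · cell `res-hironaka`, HUMAN RULING D-0089] Helper file `--supports stmt-ResolutionOfSingularities-19897` (line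
`local-engine` of res-L1-w43-plan-1, RULING gen 11 #5 / gen 12 #10 variant (V-AQS), spec `L/res-type-047/D2-INCHART-SPEC-v2.md` §1
step (Wtie)).  SETTING: `A` a commutative ring (the affine ring `A_h` of the chart), `U = (y′, x′)` and weights `(r, q)` — the GLOBAL
lex-maximal datum along the curve —, `B = extReesAlgebra (weightedMonomialIdeal U (r, q))` the global move, `f ∈ A` with global transform
`f = (t⁻¹)^{rn} · G` in `B`; `𝔮` a prime of `A` with `S = A_𝔮` regular of dimension `3` at which `f/1` is a TIE POSITION of order `n`
(`Iota3.IsTiePosition`, res-type-092) whose top-stratum prime `P₀` contains `U/1`, `U/1` having independent differentials, and `(U/1/1; (r,q); ℓ)`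
lex-maximal at `S_{P₀}`.  CONCLUSION (`TieFinite.exists_noDrop_prime_of_isTiePosition`): there is a prime `𝔫` of `B` over `𝔮`
(`𝔫 ∩ A = 𝔮`) with `t⁻¹ ∈ 𝔫`, OFF THE VERTEX, and `G/1 ∈ 𝔪_{B_𝔫}ⁿ` — a point of the no-drop locus
`W = {t⁻¹ ∈ 𝔫, vertex ⊄ 𝔫, G/1 ∈ 𝔪_𝔫ⁿ}` over `𝔮`.

Chain: unpack the tie presentation `(x₁, y₁, z₁; q₁, r₁; λ₁)` at `S`; `…TiePresentationTransfer` (p545526) gives `(r, q) = (r₁, q₁)` and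
`𝒥ₘ(U/1) = 𝒥ₘ(y₁, x₁)` on `S`, i.e. the binder `hI'` of res-D-brk-1's dictionary for `I' :=` the tie presentation's own filtration;
`ContactCylinder.exists_ringHom_localMove_isLocalization'` (p538779) gives `ψ : B → B' = extReesAlgebra I'` with `ψ t⁻¹ = t⁻¹`, so
`f/1 = (t⁻¹)^{rn} · ψ G` in `B'`; `Iota3.IsTiePresentation.exists_successor_le_adicOrder` (p543760) gives the no-drop successor `𝔫'` of
the LOCAL move (`X₁ ∉ 𝔫'`, `𝔫' ∩ S = 𝔪_S`, `(ψ G)/1 ∈ 𝔪_{𝔫'}ⁿ`); `ContactCylinder.exists_ringHom_ringEquiv_of_prime_localMove'` (GlobalMove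
rev 4) reads it at `𝔫 = ψ⁻¹ 𝔫'` with `B_𝔫 ≃ B'_{𝔫'}` (`mem_maximalIdeal_pow_iff_of_dictionary`, p542453); and §1 here transports the
vertex: `vertexIdeal B ≤ ψ⁻¹ 𝔫' ⇒ vertexIdeal I' ≤ 𝔫'` (`vertexIdeal_le_of_vertexIdeal_le_comap`), contradicting `X₁ ∈ vertexIdeal I' ∖ 𝔫'`.

[OURS] Replaces the role of NO printed item; NOT a statement of the manuscript under review [claim: Hironaka2017, status:
under-review].  AI work, weaker than expert review.  Def-free.

## References

* D. Abramovich, M. H. Quek, B. Schober, arXiv:2507.01232 (v3, 2026), Thm 1.3 (3), Thm 3.5, §5. [AbramovichQuekSchober2025]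
* J. Włodarczyk, *Functorial resolution except for toroidal locus. Toroidal compactification*, Def. 5.1.1 (localisation of the full
  cobordant blow-up). [Wlodarczyk2022]
-/

noncomputable section

set_option linter.dupNamespace false -- mandated namespace `Summit.<Summit>.<Problem>` of this single-conjunct summit

open IsLocalRing Literature.AlgebraicGeometry.Resolution LaurentPolynomial
open Summit.ResolutionOfSingularities.ResolutionOfSingularities.Theorems

namespace Summit.ResolutionOfSingularities.ResolutionOfSingularities.Cruxes.HypersurfaceCentreConstruction.LocalEngine

namespace TieFinite

/-! ## §1 The vertex along the dictionary -/

section Vertex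

variable {A S : Type} [CommRing A] [CommRing S] (φ : A →+* S) {m : ℕ} (U : Fin m → A) (W : Fin m → ℕ)
  {I' : ℕ → Ideal S} (hI' : ∀ n, I' n = (weightedMonomialIdeal U W n).map φ)
  (ψ : extReesAlgebra (weightedMonomialIdeal U W) →+* extReesAlgebra I')
  (hψ : ∀ b : extReesAlgebra (weightedMonomialIdeal U W),
    ((ψ b : extReesAlgebra I') : S[T;T⁻¹]) = AddMonoidAlgebra.mapRingHom ℤ φ (b : A[T;T⁻¹]))

include hψ in
/-- A coefficientwise ring map sends the monomial `a tⁿ` of `B` to the monomial `φ(a) tⁿ` of `B'`. [folklore] -/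
theorem map_monomial_eq {n : ℕ} (hn : 0 < n) {a : A} (ha : a ∈ weightedMonomialIdeal U W n)
    (h' : C (φ a) * T (n : ℤ) ∈ extReesAlgebra I') :
    ψ ⟨C a * T (n : ℤ), extReesAlgebra.C_mul_T_mem _ hn ha⟩ = ⟨C (φ a) * T (n : ℤ), h'⟩ := by
  apply Subtype.ext
  rw [hψ]
  change AddMonoidAlgebra.mapRingHom ℤ φ (C a * T (n : ℤ)) = C (φ a) * T (n : ℤ)
  rw [← single_eq_C_mul_T, ← single_eq_C_mul_T, AddMonoidAlgebra.mapRingHom_single]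

include hI' hψ in
/-- **The vertex of the local move lies over the vertex of the global move**: if `vertexIdeal B ≤ ψ⁻¹ 𝔫'` then
`vertexIdeal (extReesAlgebra I') ≤ 𝔫'` (a generator `a′ tⁿ`, `a′ ∈ I'ₙ = 𝒥ₙ · S`, is an `S`-combination of the images
`ψ(a tⁿ)`, `a ∈ 𝒥ₙ`). [cite: Wlodarczyk2022, Def. 5.1.1] -/
theorem vertexIdeal_le_of_vertexIdeal_le_comap (𝔫' : Ideal (extReesAlgebra I'))
    (hle : extReesAlgebra.vertexIdeal (weightedMonomialIdeal U W) ≤ 𝔫'.comap ψ) :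
    extReesAlgebra.vertexIdeal I' ≤ 𝔫' := by
  classical
  refine Ideal.span_le.mpr ?_
  rintro x ⟨n, hn, a', ha', hx⟩
  -- every `a ∈ I' n = (𝒥ₙ).map φ` has `a tⁿ ∈ 𝔫'`
  have key : ∀ a ∈ I' n, ∀ h : C a * T (n : ℤ) ∈ extReesAlgebra I', (⟨C a * T (n : ℤ), h⟩ : extReesAlgebra I') ∈ 𝔫' := by
    intro a ha
    rw [hI' n, Ideal.map, Ideal.span] at ha
    refine Submodule.span_induction (p := fun a _ => ∀ h : C a * T (n : ℤ) ∈ extReesAlgebra I',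
      (⟨C a * T (n : ℤ), h⟩ : extReesAlgebra I') ∈ 𝔫') ?_ ?_ ?_ ?_ ha
    · rintro _ ⟨a₀, ha₀, rfl⟩ h
      rw [← map_monomial_eq φ U W ψ hψ hn ha₀ h]
      exact hle (Ideal.subset_span ⟨n, hn, a₀, ha₀, rfl⟩)
    · intro h
      have h0 : (⟨C (0 : S) * T (n : ℤ), h⟩ : extReesAlgebra I') = 0 := Subtype.ext (by simp)
      rw [h0]; exact zero_mem _
    · intro a b ha hb iha ihb h
      have hsa : a ∈ I' n := by rw [hI' n, Ideal.map, Ideal.span]; exact ha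
      have hsb : b ∈ I' n := by rw [hI' n, Ideal.map, Ideal.span]; exact hb
      have hma := extReesAlgebra.C_mul_T_mem I' hn hsa
      have hmb := extReesAlgebra.C_mul_T_mem I' hn hsb
      have hadd : (⟨C (a + b) * T (n : ℤ), h⟩ : extReesAlgebra I') = ⟨_, hma⟩ + ⟨_, hmb⟩ :=
        Subtype.ext (by simp [add_mul])
      rw [hadd]; exact add_mem (iha hma) (ihb hmb)
    · intro c a ha iha h
      have hsa : a ∈ I' n := by rw [hI' n, Ideal.map, Ideal.span]; exact ha
      have hma := extReesAlgebra.C_mul_T_mem I' hn hsa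
      have hmul : (⟨C (c • a) * T (n : ℤ), h⟩ : extReesAlgebra I') = algebraMap S (extReesAlgebra I') c * ⟨_, hma⟩ :=
        Subtype.ext (by simp [smul_eq_mul, mul_assoc, Subalgebra.coe_algebraMap])
      rw [hmul]; exact Ideal.mul_mem_left _ _ (iha hma)
  have hxmem : C a' * T (n : ℤ) ∈ extReesAlgebra I' := by rw [← hx]; exact x.2
  have hx' : x = ⟨C a' * T (n : ℤ), hxmem⟩ := Subtype.ext hx
  rw [hx']
  exact key a' ha' hxmem

end Vertex

/-! ## §2 (Wtie): every tie point of the curve is a point of the no-drop locus of the GLOBAL move -/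

section Catch

variable {A : Type} [CommRing A]

/-- **(Wtie) EVERY TIE POINT IS CAUGHT BY THE GLOBAL NO-DROP LOCUS.**  `B = extReesAlgebra (weightedMonomialIdeal U (r, q))` the global
move on the lex-maximal datum `U = (y′, x′)`, `f = (t⁻¹)^{rn} · G` in `B`; `𝔮` a prime of `A` with `A_𝔮` regular of dimension `3` at
which `f/1 ∈ 𝔪ⁿ ∖ 𝔪ⁿ⁺¹` is a tie position (`Iota3.IsTiePosition`) with top-stratum prime `P₀ ∋ U/1`, `U/1` with independent
differentials, and `(U/1/1; (r, q); ℓ)` lex-maximal at `(A_𝔮)_{P₀}`.  Then some prime `𝔫` of `B` with `𝔫 ∩ A = 𝔮`, `t⁻¹ ∈ 𝔫`, OFF the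
vertex, has `G/1 ∈ 𝔪_{B_𝔫}ⁿ`. [cite: AbramovichQuekSchober2025, Thm 1.3 (3), Thm 3.5] -/
theorem exists_noDrop_prime_of_isTiePosition (𝔮 : Ideal A) [𝔮.IsPrime] [IsRegularLocalRing (Localization.AtPrime 𝔮)]
    {f : A} {n : ℕ} (htie : Iota3.IsTiePosition (Localization.AtPrime 𝔮) (algebraMap A (Localization.AtPrime 𝔮) f))
    (hfn : algebraMap A (Localization.AtPrime 𝔮) f ∈ maximalIdeal (Localization.AtPrime 𝔮) ^ n)
    (hfn' : algebraMap A (Localization.AtPrime 𝔮) f ∉ maximalIdeal (Localization.AtPrime 𝔮) ^ (n + 1))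
    (P₀ : Ideal (Localization.AtPrime 𝔮)) [P₀.IsPrime]
    (hP₀ : ContactCylinder.topStratumPrime Iota3.iotaOrdEps (Localization.AtPrime 𝔮) (algebraMap A (Localization.AtPrime 𝔮) f) = P₀)
    (U : Fin 2 → A) {r q : ℕ}
    (hu : ∀ i, algebraMap A (Localization.AtPrime 𝔮) (U i) ∈ maximalIdeal (Localization.AtPrime 𝔮))
    (hli : LinearIndependent (ResidueField (Localization.AtPrime 𝔮)) fun i =>
      (maximalIdeal (Localization.AtPrime 𝔮)).toCotangent ⟨algebraMap A (Localization.AtPrime 𝔮) (U i), hu i⟩)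
    (huP : ∀ i, algebraMap A (Localization.AtPrime 𝔮) (U i) ∈ P₀) {ℓ : ℕ}
    (hlex : IsLexMaxWeightedCentreGerm (Localization.AtPrime P₀)
      (Ideal.span {algebraMap (Localization.AtPrime 𝔮) (Localization.AtPrime P₀) (algebraMap A (Localization.AtPrime 𝔮) f)})
      (fun i => algebraMap (Localization.AtPrime 𝔮) (Localization.AtPrime P₀) (algebraMap A (Localization.AtPrime 𝔮) (U i)))
      ![r, q] ℓ)
    {G : extReesAlgebra (weightedMonomialIdeal U ![r, q])}
    (hfg : algebraMap A (extReesAlgebra (weightedMonomialIdeal U ![r, q])) f =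
      extReesAlgebra.tInv (weightedMonomialIdeal U ![r, q]) ^ (r * n) * G) :
    ∃ 𝔫 : PrimeSpectrum (extReesAlgebra (weightedMonomialIdeal U ![r, q])),
      extReesAlgebra.tInv (weightedMonomialIdeal U ![r, q]) ∈ 𝔫.asIdeal ∧
      ¬ extReesAlgebra.vertexIdeal (weightedMonomialIdeal U ![r, q]) ≤ 𝔫.asIdeal ∧
      𝔫.asIdeal.comap (algebraMap A (extReesAlgebra (weightedMonomialIdeal U ![r, q]))) = 𝔮 ∧
      algebraMap _ (Localization.AtPrime 𝔫.asIdeal) G ∈ maximalIdeal (Localization.AtPrime 𝔫.asIdeal) ^ n := by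
  classical
  obtain ⟨_, hdim3, -, -, x₁, y₁, z₁, q₁, r₁, lam₁, hpres⟩ := htie
  -- transfer: `(r, q) = (r₁, q₁)` and the two filtrations agree on `A_𝔮`
  obtain ⟨hw, -, heq⟩ := hpres.weightedMonomialIdeal_eq_of_isLexMax hdim3 hfn hfn' P₀ hP₀ hu hli huP hlex
  have hr : r = r₁ := by have h := congrFun hw 0; simpa using h
  have hq : q = q₁ := by have h := congrFun hw 1; simpa using h
  subst hr hq
  have hI' : ∀ m, weightedMonomialIdeal ![y₁, x₁] ![r, q] m =
      (weightedMonomialIdeal U ![r, q] m).map (algebraMap A (Localization.AtPrime 𝔮)) := fun m => by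
    rw [weightedMonomialIdeal_map]; exact (heq m).symm
  -- the dictionary `ψ : B → B'` onto the tie presentation's own local move
  obtain ⟨ψ, hψc, hψa, hψt, -⟩ := ContactCylinder.exists_ringHom_localMove_isLocalization' U ![r, q] 𝔮 hI'
  have hfg' : algebraMap (Localization.AtPrime 𝔮) (extReesAlgebra (weightedMonomialIdeal ![y₁, x₁] ![r, q]))
      (algebraMap A (Localization.AtPrime 𝔮) f) =
      extReesAlgebra.tInv (weightedMonomialIdeal ![y₁, x₁] ![r, q]) ^ (r * n) * ψ G := by
    rw [← hψa, hfg, map_mul, map_pow, hψt]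
  -- the no-drop successor of the LOCAL move (p543760)
  obtain ⟨𝔫', hT', -, hX1', hcomap', hmem', -⟩ := hpres.exists_successor_le_adicOrder hdim3 hfn hfn' hfg'
  -- read at `𝔫 = ψ⁻¹ 𝔫'` (GlobalMove rev 4)
  obtain ⟨ψ₂, g, hψ₂c, -, -, -, hg⟩ :=
    ContactCylinder.exists_ringHom_ringEquiv_of_prime_localMove' U ![r, q] 𝔮 hI' 𝔫'.asIdeal
  have hψeq : ψ₂ = ψ := ContactCylinder.ringHom_eq_of_coe_eq_mapRingHom _ ψ₂ ψ hψ₂c hψc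
  subst hψeq
  refine ⟨⟨𝔫'.asIdeal.comap ψ₂, Ideal.comap_isPrime ψ₂ 𝔫'.asIdeal⟩, ?_, ?_, ?_, ?_⟩
  · change extReesAlgebra.tInv (weightedMonomialIdeal U ![r, q]) ∈ 𝔫'.asIdeal.comap ψ₂
    rw [Ideal.mem_comap, hψt]
    exact hT'
  · intro hle
    have hq0 : 0 < q := by simpa using hlex.2.1 1
    have hX1mem : LocalGameEFTPointMove.uT ![y₁, x₁] ![r, q] 1 ∈
        extReesAlgebra.vertexIdeal (weightedMonomialIdeal ![y₁, x₁] ![r, q]) :=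
      Ideal.subset_span ⟨q, hq0, x₁, by simpa using mem_weightedMonomialIdeal_self ![y₁, x₁] ![r, q] 1, rfl⟩
    exact hX1' (vertexIdeal_le_of_vertexIdeal_le_comap (algebraMap A (Localization.AtPrime 𝔮)) U ![r, q] hI' ψ₂ hψc
      𝔫'.asIdeal hle hX1mem)
  · change (𝔫'.asIdeal.comap ψ₂).comap (algebraMap A (extReesAlgebra (weightedMonomialIdeal U ![r, q]))) = 𝔮
    have hcomp : ψ₂.comp (algebraMap A (extReesAlgebra (weightedMonomialIdeal U ![r, q]))) =
        (algebraMap (Localization.AtPrime 𝔮) (extReesAlgebra (weightedMonomialIdeal ![y₁, x₁] ![r, q]))).comp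
          (algebraMap A (Localization.AtPrime 𝔮)) :=
      RingHom.ext fun a => by simp only [RingHom.comp_apply, hψa]
    rw [Ideal.comap_comap, hcomp, ← Ideal.comap_comap, hcomap']
    exact Localization.AtPrime.under_maximalIdeal (I := 𝔮)
  · exact (ContactCylinder.mem_maximalIdeal_pow_iff_of_dictionary ψ₂ (𝔫'.asIdeal.comap ψ₂) 𝔫'.asIdeal g hg G n).mpr hmem'

end Catch

end TieFinite

end Summit.ResolutionOfSingularities.ResolutionOfSingularities.Cruxes.HypersurfaceCentreConstruction.LocalEngine

end
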